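import Summits.QuantumFields.BalabanUV.T4Continuum.Spine.NE3.QbarDictionary
import Literature.MathematicalPhysics.QuantumFieldTheory.Balaban1983to89.B7Eq123General
import HarnessLib

/-!
# T⁴ programme, node NE3 — REPAIR R24 (β): THE k-FOLD LINEARISED DOUBLE-BAR AVERAGE OF THE B8 DIRECTION IS MINUS THE [B7] PROPOSITION 4
# REMAINDER — `adField (cavgIter L k W) (QbarIter L k W Z) = −(logCovIter − linCovIter) L W (adField W Z) k` from (1.37) (`LandauRepB8Avg.dbar`), i.e.
# the double-bar analogue of route Π's non-linear fibre equation (Π-C): the defect of the B8 representative from its tangent slice `slicB8` is the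
# (quadratically small, k-uniformly bounded — `B7Prop4GeneralLevels.prop4_general_remainder_at_k`) composite remainder of Bałaban's averaging

Cell `pub-balaban-gaps` (YM blitz, track G2, seat `ne3`, unit `pub-balaban-gaps-ne3`; writer prover-pub-balaban-gaps-ne3-g2-0, 2026-08-22), census
`run/shared/lean/pub/pub-balaban-gaps/ne/NE3.md` §4 R24 (ii)(β).  Inputs BY NAME: `Spine/NE3/QbarDictionary` (p342842 ✓: `adField`, `Qbar_eq_Ad_linQcov`),
`Spine/NE3/PairLandauB8Avg` (p341788 ✓: `LandauRepB8Avg.dbar`, `relPert`), the b07 lineage's composites `B7Prop4GeneralLevels.logCovIter` ∕ `linCovIter`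
([Balaban1985Averaging] (127) «Q_j(U₀, ηA)» and p. 38 «Q_{j+1}(U₀) = Q(Ū₀ʲ)Q_j(U₀)», the non-linear and the linear composites of the one-step maps, outer-last
recursion exactly as `B7Eq92Concrete.dbavgCovIter`), `B7Eq92Concrete.dbavgCovIter_succ`, `MatrixLog.mlog_one`, T4's `NE3TangentCovariantTower.QbarIter` ∕
`QbarIter_succ'` ∕ `cavgIter_succ'`, `AveragingDeficitMultiLevelBridge.cavgIter_eq_avgIter`.

CONTENT (0 sorry, no `def`):
§1 `logCovIter_succ_eq_mlog_dbavgCovIter` — if the `j`-th double-bar average of `e^{A}` is the exponential of the `j`-th composite (the tree's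
   `B7Prop6GeneralLevels.dbavgCovIter_eq_expCfg_logCovIter` supplies this in the small regime; here a HYPOTHESIS), then the `(j+1)`-th composite IS the
   logarithm of the `(j+1)`-th double-bar average (by the two outer-last recursions — no smallness); **`logCovIter_eq_zero_of_dbar`** — hence (1.37)
   `dbavgCovIter L W (expCfg A) (j+1) = 1` forces `logCovIter L W A (j+1) = 0` (`mlog 1 = 0`);
§2 **`linCovIter_adField`** — the LINEAR composite in the start frame IS the tree's `QbarIter` in the end frame, level by level:
   `linCovIter L W (adField W Y) j = adField (cavgIter L j W) (QbarIter L j W Y)` (induction over `Qbar_eq_Ad_linQcov`, under the one-block loop smallness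
   `‖Wcx − 1‖ < 1` of every averaged background `cavgIter L i W`, `i < j`);
§3 **`adField_QbarIter_eq_neg_remainder`** — the Π-C IDENTITY ON B8's SURFACE: under (1.37) at level `k = j+1`, the exponential identification at level `j`
   and the loop smallness, `adField (cavgIter L (j+1) W) (QbarIter L (j+1) W Z) = −(logCovIter L W (adField W Z) (j+1) − linCovIter L W (adField W Z) (j+1))`,
   whose right side [B7] Prop. 4 (130)–(135) bounds by `8C₁e^{4cα₀}·(L^{j+1}·sup‖adField W Z‖)²` k-UNIFORMLY (`prop4_general_remainder_at_k`; with B8's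
   (1.36) `sup‖Z‖ ≤ s₁ξ`: `≤ 8C₁e^{4cα₀}·s₁²`) — the normal datum of the chart supplier is QUADRATIC in `s₁` and k-free; and `LandauRepB8Avg.adField_QbarIter`,
   the same read off the shape's `dbar` field;
§4 **`norm_adField_QbarIter_le`** — THE QUANTITATIVE FORM over a unitary background `W` in the regime of the tree's UNCONDITIONAL [B7] Prop. 4
   (`B7Eq123General.prop4_general`, `dbavgCovIter_eq_expCfg_logCovIter`, `level_data`, `blockLoops_of_pdev`; `pdev W < α₀ξ²`, `C0·α₀ ≤ 1∕3`, `4α₀ ≤ c2′`,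
   `sup‖Z‖ ≤ b`, `e^{3200(d+1)²(d+4)α₀}(1 + 8·131072(d+1)²·L^k b) ≤ 2`, `2L^k b ≤ c3`): every hypothesis of §3 is DISCHARGED and
   `‖adField (cavgIter L k W) (QbarIter L k W Z) (c)‖ ≤ 8·131072(d+1)²·e^{3200(d+1)²(d+4)α₀}·(L^k b)²` — with B8's (1.36) `b = s₁ξ`: `≤ const(d)·s₁²`, k-FREE;
   `norm_QbarIter_le` — the same for `QbarIter` itself when the level-`k` background is unitary (`Ad` is an isometry).

WHAT REMAINS of R24 after this file: (γ) the right inverse of `QbarIter L k W` in the (1.38)-complement WITH LETTERS (sup ∕ ℓ¹ ∕ curl of the preimage;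
surjectivity itself is `B9Eq315QTower`), the smallness hypotheses of §3 being discharged in §4 from the background's plaquette deviation `pdev W < α₀ξ²` (the small-field class radius) and the sup size of `Z`.

HONEST FRAMING.  Exact identities of the lineage's formal objects; the remainder BOUND is the tree's [B7] Prop. 4 (not re-proved here); nothing about
Bałaban's minimisers is asserted; the chart supplier, (P♮), (RES♯), the covariant root and **NE3 are NOT proved**; spine PROVED 0∕9; finite T⁴ rung (B)+1 —
NOT infinite volume, NOT mass gap, NOT `BetaPertH`, NOT Clay.  ABSOLUTE RULE kept (context only: [Balaban1985Averaging] (127)–(135) pp. 37–38;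
[Balaban1985RegularSpaces] (1.37) p. 82).  PLACEMENT: `Summits/QuantumFields/BalabanUV/T4Continuum/Spine/NE3/`; imports accepted modules only; moves nothing.
HONEST DEPENDENCY: continuum YM on T⁴ ⇐ BetaPertH ∧ nine spine estimates (0/9 proved); BetaPertH ⇐ (D1) ∧ (D4) ∧ CAP+tail; G-an2-4 gates asym, D1 and NE2/3/4.
-/

set_option autoImplicit false

open scoped BigOperators Matrix Matrix.Norms.L2Operator
open NormedSpace Finset

namespace Summit.QuantumFields.BalabanUV.T4Continuum.NE3.QbarTowerB8

open Literature.MathematicalPhysics.QuantumFieldTheory.Balaban1983to89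
open B7Prop1Explicit B7Prop2Explicit B7Prop3Flat MatrixLog
open T4AveragingDeficitWall (Ad IsUnitaryCfg)
open AveragingDeficitTransport (norm_Ad_of_unitary)
open AveragingDeficitChartCalculus (cavg)
open AveragingDeficitMultiLevelPrep (cavgIter)
open AveragingDeficitMultiLevelBridge (cavgIter_eq_avgIter)
open NE3TangentCovariantStructure (Qbar)
open NE3TangentCovariantTower (QbarIter QbarIter_succ' cavgIter_succ')
open B7Eq92Concrete (dbavgCov dbavgCovIter dbavgCovIter_succ)
open B7Prop3GeneralLinear (Qcov linQcov)
open B7Prop4GeneralLevels (logCovIter linCovIter logCovIter_succ linCovIter_succ)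
open B7Eq123General (prop4_general level_data blockLoops_of_pdev)
open NE3.PairLandauB8Avg (relPert LandauRepB8Avg)
open NE3.QbarDictionary (adField relPert_eq_expCfg_adField Qbar_eq_Ad_linQcov)

noncomputable section

variable {d : ℕ} {n : Type*} [Fintype n] [DecidableEq n]

/-! ## §1 The last composite is the logarithm of the last double-bar average; (1.37) kills it -/

/-- **THE `(j+1)`-TH COMPOSITE IS THE LOGARITHM OF THE `(j+1)`-TH DOUBLE-BAR AVERAGE** whenever the `j`-th double-bar average of `e^{A}` is the exponential of
the `j`-th composite: both objects recurse outer-last through the one-step map at the background `Ū₀ʲ = avgIter L W j` ([Balaban1985Averaging] (91) ∕ (127)),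
and `Qcov = mlog ∘ dbavgCov ∘ expCfg` by definition. [folklore] -/
theorem logCovIter_succ_eq_mlog_dbavgCovIter (L : ℕ) (W : Site d → Fin d → (Matrix n n ℂ)ˣ) (A : Site d → Fin d → Matrix n n ℂ) (j : ℕ)
    (hj : dbavgCovIter L W (expCfg A) j = expCfg (logCovIter L W A j)) (z : Site d) (κ : Fin d) :
    logCovIter L W A (j + 1) z κ = mlog ((dbavgCovIter L W (expCfg A) (j + 1) z κ : (Matrix n n ℂ)ˣ) : Matrix n n ℂ) := by
  rw [logCovIter_succ, dbavgCovIter_succ, hj]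
  rfl

/-- **(1.37) KILLS THE LAST COMPOSITE**: if the `(j+1)`-th double-bar average of `e^{A}` is trivial and the `j`-th one is the exponential of the `j`-th composite,
then `logCovIter L W A (j+1) = 0` (`mlog 1 = 0`). [folklore] -/
theorem logCovIter_eq_zero_of_dbar (L : ℕ) (W : Site d → Fin d → (Matrix n n ℂ)ˣ) (A : Site d → Fin d → Matrix n n ℂ) (j : ℕ)
    (hj : dbavgCovIter L W (expCfg A) j = expCfg (logCovIter L W A j)) (hdbar : dbavgCovIter L W (expCfg A) (j + 1) = 1) :
    logCovIter L W A (j + 1) = fun _ _ => 0 := by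
  funext z κ
  rw [logCovIter_succ_eq_mlog_dbavgCovIter L W A j hj, hdbar]
  show mlog (((1 : Site d → Fin d → (Matrix n n ℂ)ˣ) z κ : (Matrix n n ℂ)ˣ) : Matrix n n ℂ) = 0
  rw [Pi.one_apply, Pi.one_apply, Units.val_one, mlog_one]

/-! ## §2 The linear composite in the start frame is `QbarIter` in the end frame -/

/-- **`linCovIter L W (adField W Y) j = adField (cavgIter L j W) (QbarIter L j W Y)`** — the composite of the linear parts «L^jη·Q_j(U₀)» ([Balaban1985Averaging]
p. 38) applied to the start-framed field `Ad_W Y` IS the tree's k-fold linearised double-bar average of `Y`, conjugated to the start frame of the level-`j`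
background; by induction over the one-level dictionary `Qbar_eq_Ad_linQcov`, under the one-block loop smallness of every averaged background
`cavgIter L i W`, `i < j`. [folklore] -/
theorem linCovIter_adField [Nonempty n] (L : ℕ) (W : Site d → Fin d → (Matrix n n ℂ)ˣ) (Y : Site d → Fin d → Matrix n n ℂ) :
    ∀ j : ℕ, (∀ i < j, ∀ (z : Site d) (κ : Fin d) (r : Fin d → Fin L),
        ‖((Wcx L (cavgIter L i W) ((L : ℤ) • z) κ (boxVec L r) : (Matrix n n ℂ)ˣ) : Matrix n n ℂ) - 1‖ < 1) →
      linCovIter L W (adField W Y) j = adField (cavgIter L j W) (QbarIter L j W Y)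
  | 0, _ => rfl
  | j + 1, hW => by
    have ih := linCovIter_adField L W Y j (fun i hi => hW i (Nat.lt_succ_of_lt hi))
    funext z κ
    rw [linCovIter_succ, ih, ← cavgIter_eq_avgIter, QbarIter_succ', cavgIter_succ']
    show linQcov L (cavgIter L j W) (adField (cavgIter L j W) (QbarIter L j W Y)) ((L : ℤ) • z) κ
      = Ad (bavg L (cavgIter L j W) ((L : ℤ) • z) κ) (Qbar L (cavgIter L j W) (QbarIter L j W Y) z κ)
    rw [Qbar_eq_Ad_linQcov L (cavgIter L j W) (QbarIter L j W Y) z κ (hW j (Nat.lt_succ_self j) z κ),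
      NE3GaugeDirFrames.Ad_Ad_inv]

/-! ## §3 The Π-C identity on B8's surface -/

/-- **THE Π-C IDENTITY ON B8's SURFACE**: if the k-th (`k = j+1`) double-bar average of `e^{A}`, `A = adField W Z`, relative to `W` is trivial ((1.37) at the pair),
the `j`-th one is the exponential of the `j`-th composite, and every averaged background has one-block loops within `1` of the identity, then
`adField (cavgIter L (j+1) W) (QbarIter L (j+1) W Z) = −(logCovIter L W A (j+1) − linCovIter L W A (j+1))` — the k-fold linearised double-bar average of the B8
direction is MINUS the composite remainder of [Balaban1985Averaging] Prop. 4, which `B7Prop4GeneralLevels.prop4_general_remainder_at_k` bounds by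
`8C₁e^{4cα₀}·(L^{j+1}·sup‖A‖)²`, k-uniformly. [folklore] -/
theorem adField_QbarIter_eq_neg_remainder [Nonempty n] (L : ℕ) (W : Site d → Fin d → (Matrix n n ℂ)ˣ) (Z : Site d → Fin d → Matrix n n ℂ)
    (j : ℕ) (hj : dbavgCovIter L W (expCfg (adField W Z)) j = expCfg (logCovIter L W (adField W Z) j))
    (hdbar : dbavgCovIter L W (expCfg (adField W Z)) (j + 1) = 1)
    (hW : ∀ i < j + 1, ∀ (z : Site d) (κ : Fin d) (r : Fin d → Fin L),
      ‖((Wcx L (cavgIter L i W) ((L : ℤ) • z) κ (boxVec L r) : (Matrix n n ℂ)ˣ) : Matrix n n ℂ) - 1‖ < 1) :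
    adField (cavgIter L (j + 1) W) (QbarIter L (j + 1) W Z)
      = -(logCovIter L W (adField W Z) (j + 1) - linCovIter L W (adField W Z) (j + 1)) := by
  rw [← linCovIter_adField L W Z (j + 1) hW, logCovIter_eq_zero_of_dbar L W (adField W Z) j hj hdbar]
  funext z κ
  simp

/-- **THE SAME, READ OFF THE SHAPE `LandauRepB8Avg`**: its field `dbar : dbavgCovIter L W (relPert W Z) k = 1` is (1.37) with `relPert W Z = expCfg (adField W Z)`.
[folklore] -/
theorem LandauRepB8Avg.adField_QbarIter [Nonempty n] {L N j : ℕ} {W UA : Site d → Fin d → (Matrix n n ℂ)ˣ} {u : Site d → (Matrix n n ℂ)ˣ}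
    {Z : Site d → Fin d → Matrix n n ℂ} {s₁ s₂ β : ℝ} (h : LandauRepB8Avg L N (j + 1) W UA u Z s₁ s₂ β)
    (hj : dbavgCovIter L W (expCfg (adField W Z)) j = expCfg (logCovIter L W (adField W Z) j))
    (hW : ∀ i < j + 1, ∀ (z : Site d) (κ : Fin d) (r : Fin d → Fin L),
      ‖((Wcx L (cavgIter L i W) ((L : ℤ) • z) κ (boxVec L r) : (Matrix n n ℂ)ˣ) : Matrix n n ℂ) - 1‖ < 1) :
    adField (cavgIter L (j + 1) W) (QbarIter L (j + 1) W Z)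
      = -(logCovIter L W (adField W Z) (j + 1) - linCovIter L W (adField W Z) (j + 1)) := by
  have hdbar : dbavgCovIter L W (expCfg (adField W Z)) (j + 1) = 1 := by
    rw [← relPert_eq_expCfg_adField]; exact h.dbar
  exact adField_QbarIter_eq_neg_remainder L W Z j hj hdbar hW


/-! ## §4 The quantitative form: the normal datum is quadratic in the sup size of the direction, k-free -/

/-- **THE NORMAL DATUM OF THE B8 REPRESENTATIVE IS QUADRATIC AND k-FREE** (unitary background `W`, `L ≥ 2`): in the regime of the tree's unconditional
[Balaban1985Averaging] Prop. 4 at a general background (`B7Eq123General.prop4_general`: plaquette deviation `pdev W < α₀·((L^{j+1})⁻¹)²`, `C0·α₀ ≤ 1∕3`,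
`4α₀ ≤ c2′`, the two smallness lines in `L^{j+1}·b`, `sup‖Z‖ ≤ b`), the clause (1.37) `dbavgCovIter L W (expCfg (adField W Z)) (j+1) = 1` forces
`‖adField (cavgIter L (j+1) W) (QbarIter L (j+1) W Z) (z, κ)‖ ≤ 8·131072(d+1)²·e^{4·800(d+1)²(d+4)·α₀}·(L^{j+1}·b)²` at every coarse bond — every hypothesis of
`adField_QbarIter_eq_neg_remainder` discharged (`dbavgCovIter_eq_expCfg_logCovIter`, `level_data` + `blockLoops_of_pdev` for the loop smallness of the
averaged backgrounds) and the right side bounded by (130) k-uniformly.  With [Balaban1985RegularSpaces] (1.36) `b = s₁·ξ`, `L^{j+1}·b = s₁`: the bound is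
`const(d)·s₁²`, independent of the level. [folklore] -/
theorem norm_adField_QbarIter_le [Nonempty n] (L : ℕ) (hL : 2 ≤ L) (W : Site d → Fin d → (Matrix n n ℂ)ˣ) (hWu : IsUnitaryCfg W)
    (Z : Site d → Fin d → Matrix n n ℂ) (j : ℕ) {α₀ b : ℝ} (hα : 0 < α₀) (hα3 : C0 d * α₀ ≤ 1 / 3) (hα4 : 4 * α₀ ≤ c2' d L)
    (h52 : pdev W < α₀ * (((L : ℝ) ^ (j + 1))⁻¹) ^ 2) (hb : 0 ≤ b) (hZ : ∀ (x : Site d) (κ : Fin d), ‖Z x κ‖ ≤ b)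
    (hsmall : Real.exp (4 * (800 * ((d : ℝ) + 1) ^ 2 * ((d : ℝ) + 4)) * α₀)
      * (1 + 8 * (131072 * ((d : ℝ) + 1) ^ 2) * ((L : ℝ) ^ (j + 1) * b)) ≤ 2)
    (hc₃ : 2 * ((L : ℝ) ^ (j + 1) * b) ≤ c3 d L)
    (hdbar : dbavgCovIter L W (expCfg (adField W Z)) (j + 1) = 1) :
    ∀ (z : Site d) (κ : Fin d), ‖adField (cavgIter L (j + 1) W) (QbarIter L (j + 1) W Z) z κ‖
      ≤ 8 * (131072 * ((d : ℝ) + 1) ^ 2) * Real.exp (4 * (800 * ((d : ℝ) + 1) ^ 2 * ((d : ℝ) + 4)) * α₀)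
          * ((L : ℝ) ^ (j + 1) * b) ^ 2 := by
  letI : CStarAlgebra (Matrix n n ℂ) := {}
  have hG := avgClosed_unitaryUnits d (𝔸 := Matrix n n ℂ) L
  have hU₀ : ∀ (x : Site d) (κ : Fin d), W x κ ∈ unitaryUnits (Matrix n n ℂ) := hWu
  have hB : ∀ (x : Site d) (κ : Fin d), ‖adField W Z x κ‖ ≤ b := fun x κ => by
    unfold adField
    rw [norm_Ad_of_unitary (hWu x κ)]
    exact hZ x κ
  have h4 := prop4_general L hL hG (j + 1) W hU₀ hα hα3 hα4 h52 (adField W Z) hb hB hsmall hc₃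
  have hQ := B7Eq123General.dbavgCovIter_eq_expCfg_logCovIter L hL hG (j + 1) W hU₀ hα hα3 hα4 h52 (adField W Z) hb hB hsmall hc₃
  have hld := level_data L hL hG (j + 1) W hU₀ hα hα3 hα4 h52
  have hL1 : 1 ≤ L := by omega
  -- loop smallness of every averaged background, from its plaquette deviation
  have hW : ∀ i < j + 1, ∀ (z : Site d) (κ : Fin d) (r : Fin d → Fin L),
      ‖((Wcx L (cavgIter L i W) ((L : ℤ) • z) κ (boxVec L r) : (Matrix n n ℂ)ˣ) : Matrix n n ℂ) - 1‖ < 1 := by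
    intro i hi z κ r
    obtain ⟨hV, hβ0, hβ, hβmax⟩ := hld i hi.le
    rw [cavgIter_eq_avgIter]
    have h := blockLoops_of_pdev hL1 hV hβ0 hβ hβmax ((L : ℤ) • z) κ
    exact ((h.1 r).trans h.2).trans_lt (by norm_num)
  have hid := adField_QbarIter_eq_neg_remainder L W Z j (hQ j (Nat.le_succ j)) hdbar hW
  intro z κ
  have hb4 := (h4 (j + 1) le_rfl).1 z κ
  rw [hid]
  simpa only [Pi.neg_apply, Pi.sub_apply, norm_neg] using hb4

/-- **THE SAME FOR `QbarIter` ITSELF** when the level-`(j+1)` averaged background is unitary (`Ad` by a unitary is an isometry of the operator norm). [folklore] -/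
theorem norm_QbarIter_le [Nonempty n] (L : ℕ) (hL : 2 ≤ L) (W : Site d → Fin d → (Matrix n n ℂ)ˣ) (hWu : IsUnitaryCfg W)
    (hWk : ∀ (j : ℕ), IsUnitaryCfg (cavgIter L j W))
    (Z : Site d → Fin d → Matrix n n ℂ) (j : ℕ) {α₀ b : ℝ} (hα : 0 < α₀) (hα3 : C0 d * α₀ ≤ 1 / 3) (hα4 : 4 * α₀ ≤ c2' d L)
    (h52 : pdev W < α₀ * (((L : ℝ) ^ (j + 1))⁻¹) ^ 2) (hb : 0 ≤ b) (hZ : ∀ (x : Site d) (κ : Fin d), ‖Z x κ‖ ≤ b)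
    (hsmall : Real.exp (4 * (800 * ((d : ℝ) + 1) ^ 2 * ((d : ℝ) + 4)) * α₀)
      * (1 + 8 * (131072 * ((d : ℝ) + 1) ^ 2) * ((L : ℝ) ^ (j + 1) * b)) ≤ 2)
    (hc₃ : 2 * ((L : ℝ) ^ (j + 1) * b) ≤ c3 d L)
    (hdbar : dbavgCovIter L W (expCfg (adField W Z)) (j + 1) = 1) :
    ∀ (z : Site d) (κ : Fin d), ‖QbarIter L (j + 1) W Z z κ‖
      ≤ 8 * (131072 * ((d : ℝ) + 1) ^ 2) * Real.exp (4 * (800 * ((d : ℝ) + 1) ^ 2 * ((d : ℝ) + 4)) * α₀)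
          * ((L : ℝ) ^ (j + 1) * b) ^ 2 := by
  intro z κ
  have h := norm_adField_QbarIter_le L hL W hWu Z j hα hα3 hα4 h52 hb hZ hsmall hc₃ hdbar z κ
  unfold adField at h
  rwa [norm_Ad_of_unitary (hWk (j + 1) z κ)] at h

end

end Summit.QuantumFields.BalabanUV.T4Continuum.NE3.QbarTowerB8
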